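import Literature.NumberTheory.LFunctions.MoebiusWalshVaughan
import HarnessLib

/-!
# Möbius–Walsh sums: from per-box bounds to the Walsh sum (bookkeeping layer of Bourgain 2013, §3) — proved

Topic `Literature/NumberTheory/LFunctions`, a proofs companion of `MoebiusWalshCircuits.lean`
(named facts `bourgain_moebius_walsh_uniform`, `bourgain_liouville_walsh_uniform`: J. Bourgain,
*Möbius–Walsh correlation bounds and an estimate of Mauduit and Rivat*, J. Anal. Math. **119**
(2013) 147–163 = arXiv:1109.2784 [Bourgain2013MoebiusWalsh], Theorem 1). Everything here is
PROVED (theorems only); no definition, no named fact.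

The tree's Vaughan reduction `MoebiusWalshVaughan.abs_walshSum_moebius_le_boxes` bounds
`|walshSum μ A|` by `2u + ½ ΣΣ |box_I| + (B/2) ΣΣ |box_II| + 2ⁿ(n+1)⁴/B`, the double sums running
over ALL dyadic boxes `D_i × D_j`, `i + j < n`, and over the two digit sets `T ∈ {S, S ∪ {n}}`
(`S = A.map val`). The analytic estimates of the paper (§2 type II, §3 type I) are per-box bounds,
meaningful only for LARGE boxes (`2^{i+j} ≍ 2ⁿ`); this file is the bookkeeping in between:

* `boxSum_comm` — `boxSum T i j α β = boxSum T j i β α` (so the short side may be assumed first);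
* `natWalsh_eq_natWalsh_filter`, `boxSum_eq_boxSum_filter` — on a box `D_i × D_j` only the digits
  `< i + j + 2` of `T` matter (`ab < 2^{i+j+2}`), so `T` may be cut to `[0, Λ)`, `Λ ≥ i + j + 2`;
* `abs_boxSum_typeI_trivial`, `abs_boxSum_typeII_trivial` — the trivial bounds
  `|box_I| ≤ 2^{i+j+1}(1 + log 2^{i+1})` (divisor-bounded coefficient, tree's `∑_{a≤Z} τ(a) ≤ Z(1+log Z)`)
  and `|box_II| ≤ 2^{i+j}`, used for the small boxes;
* `abs_walshSum_moebius_le_of_boxBounds` — **the criterion**: if every LARGE box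
  (`i + j < n ≤ i + j + s₀`) has `|box_I(T)| ≤ E_I` and `|box_II(T)| ≤ E_II` for both digit sets `T`,
  then `|walshSum μ A| ≤ 2u + n²(E_I + 2^{n-s₀}(n+1)) + B n²(E_II + 2^{n-s₀}) + 2ⁿ(n+1)⁴/B`.

Nothing here is specific to a route through §2: any per-box type-I/type-II estimates plug in.

## References

* J. Bourgain, J. Anal. Math. 119 (2013) 147–163; arXiv:1109.2784, §3 (reduction to (2.1), (3.1))
  and (3.10). [Bourgain2013MoebiusWalsh]
-/

noncomputable section

open Finset Real
open scoped ArithmeticFunction.Moebius ArithmeticFunction.sigma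

namespace Literature.NumberTheory.LFunctions.MoebiusWalsh

open Literature.NumberTheory.LFunctions.MoebiusWalshVaughan (natWalsh dyBlock mem_dyBlock boxSum
  abs_boxSum_le abs_natWalsh typeICoeff abs_typeICoeff_le typeIICoeffA typeIICoeffB abs_typeIICoeffA_le
  abs_typeIICoeffB_le abs_walshSum_moebius_le_boxes)

/-! ### Symmetry and digit truncation of box sums -/

/-- **Symmetry of the box sum**: `boxSum T i j α β = boxSum T j i β α` (`ab = ba`). [folklore] -/
theorem boxSum_comm (T : Finset ℕ) (i j : ℕ) (α β : ℕ → ℝ) :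
    boxSum T i j α β = boxSum T j i β α := by
  unfold boxSum
  rw [Finset.sum_comm]
  refine Finset.sum_congr rfl fun b _ => Finset.sum_congr rfl fun a _ => ?_
  rw [mul_comm a b, mul_comm (α a) (β b)]

/-- Digits `≥ Λ` of `T` do not matter on `x < 2^Λ`. [folklore] -/
theorem natWalsh_eq_natWalsh_filter (T : Finset ℕ) {L x : ℕ} (hx : x < 2 ^ L) :
    natWalsh T x = natWalsh (T.filter (· < L)) x := by
  unfold natWalsh
  rw [← Finset.prod_filter_mul_prod_filter_not T (· < L)]
  have h1 : ∏ j ∈ T.filter (fun t => ¬ t < L), (if x.testBit j then (-1 : ℝ) else 1) = 1 := by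
    refine Finset.prod_eq_one fun j hj => ?_
    have hjL : L ≤ j := not_lt.mp (Finset.mem_filter.mp hj).2
    have hxj : x < 2 ^ j := lt_of_lt_of_le hx (Nat.pow_le_pow_right (by norm_num) hjL)
    rw [Nat.testBit_lt_two_pow hxj]
    simp
  rw [h1, mul_one]

/-- On the box `D_i × D_j` the digit set may be cut to `[0, Λ)` for any `Λ ≥ i + j + 2`. [folklore] -/
theorem boxSum_eq_boxSum_filter (T : Finset ℕ) {i j L : ℕ} (hL : i + j + 2 ≤ L) (α β : ℕ → ℝ) :
    boxSum T i j α β = boxSum (T.filter (· < L)) i j α β := by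
  unfold boxSum
  refine Finset.sum_congr rfl fun a ha => Finset.sum_congr rfl fun b hb => ?_
  have hab := (MoebiusWalshVaughan.mul_mem_of_mem_dyBlock ha hb).2
  rw [natWalsh_eq_natWalsh_filter T (lt_of_lt_of_le hab (Nat.pow_le_pow_right (by norm_num) hL))]

/-! ### Trivial bounds for a box -/

/-- `∑_{a ∈ D_i} τ(a) ≤ 2^{i+1}(1 + log 2^{i+1})`. [folklore] -/
theorem sum_dyBlock_card_divisors_le (i : ℕ) :
    ∑ a ∈ dyBlock i, ((σ 0 a : ℕ) : ℝ) ≤ 2 ^ (i + 1) * (1 + Real.log (2 ^ (i + 1))) := by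
  calc ∑ a ∈ dyBlock i, ((σ 0 a : ℕ) : ℝ)
      ≤ ∑ a ∈ Ioc 0 (2 ^ (i + 1)), ((σ 0 a : ℕ) : ℝ) := by
        refine Finset.sum_le_sum_of_subset_of_nonneg ?_ fun a _ _ => by positivity
        intro a ha
        rw [mem_dyBlock] at ha
        rw [Finset.mem_Ioc]
        have := Nat.two_pow_pos i
        omega
    _ = ∑ a ∈ Ioc 0 (2 ^ (i + 1)), ((#a.divisors : ℕ) : ℝ) := by
        refine Finset.sum_congr rfl fun a _ => ?_
        rw [ArithmeticFunction.sigma_zero_apply]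
    _ ≤ (2 ^ (i + 1) : ℕ) * (1 + Real.log (2 ^ (i + 1) : ℕ)) :=
        Literature.NumberTheory.Sieve.Vaughan.sum_card_divisors_le _
    _ = 2 ^ (i + 1) * (1 + Real.log (2 ^ (i + 1))) := by push_cast; ring

/-- **Trivial bound for the type-I box**: `|box_I(T)| ≤ 2^{i+j+1}(1 + log 2^{i+1})`. [folklore] -/
theorem abs_boxSum_typeI_trivial (T : Finset ℕ) (i j u : ℕ) :
    |boxSum T i j (typeICoeff u) (fun _ => 1)| ≤ 2 ^ (i + j + 1) * (1 + Real.log (2 ^ (i + 1))) := by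
  refine (abs_boxSum_le T i j (typeICoeff u) (fun _ => 1) (fun _ => by simp)).trans ?_
  calc (∑ a ∈ dyBlock i, |typeICoeff u a|) * 2 ^ j
      ≤ (2 ^ (i + 1) * (1 + Real.log (2 ^ (i + 1)))) * 2 ^ j := by
        gcongr
        exact (Finset.sum_le_sum fun a _ => abs_typeICoeff_le u a).trans (sum_dyBlock_card_divisors_le i)
    _ = 2 ^ (i + j + 1) * (1 + Real.log (2 ^ (i + 1))) := by ring

/-- **Trivial bound for the type-II box**: `|box_II(T)| ≤ 2^{i+j}` (`B ≥ 1`). [folklore] -/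
theorem abs_boxSum_typeII_trivial (T : Finset ℕ) (i j u : ℕ) {B : ℕ} (hB : 1 ≤ B) :
    |boxSum T i j (typeIICoeffA u B) (typeIICoeffB u)| ≤ 2 ^ (i + j) := by
  refine (abs_boxSum_le T i j _ _ (abs_typeIICoeffB_le u)).trans ?_
  have hcard : ((dyBlock i).card : ℝ) = 2 ^ i := by
    have h : 2 ^ (i + 1) - 2 ^ i = 2 ^ i := by rw [pow_succ]; omega
    rw [dyBlock, Nat.card_Ico, h]; push_cast; ring
  calc (∑ a ∈ dyBlock i, |typeIICoeffA u B a|) * 2 ^ j ≤ (∑ _a ∈ dyBlock i, (1 : ℝ)) * 2 ^ j := by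
        gcongr with a _
        exact abs_typeIICoeffA_le hB u a
    _ = 2 ^ (i + j) := by rw [Finset.sum_const, nsmul_eq_mul, mul_one, hcard, pow_add]

/-! ### The double sum over boxes -/

/-- Bookkeeping for the double sum over boxes: if `0 ≤ f(i,j) ≤ F` whenever the box is large
(`n ≤ i + j + s₀`) and `f(i,j) ≤ G` whenever it is small, with `F, G ≥ 0`, then
`∑_{i<n} ∑_{j<n-i} f(i,j) ≤ n²(F + G)`. [folklore] -/
theorem sum_boxes_le {n s₀ : ℕ} {f : ℕ → ℕ → ℝ} {F G : ℝ} (hF : 0 ≤ F) (hG : 0 ≤ G)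
    (hlarge : ∀ i j, i + j < n → n ≤ i + j + s₀ → f i j ≤ F)
    (hsmall : ∀ i j, i + j < n → i + j + s₀ < n → f i j ≤ G) :
    ∑ i ∈ range n, ∑ j ∈ range (n - i), f i j ≤ (n : ℝ) ^ 2 * (F + G) := by
  have hpt : ∀ i ∈ range n, ∀ j ∈ range (n - i), f i j ≤ F + G := by
    intro i hi j hj
    have hi' := Finset.mem_range.mp hi
    have hj' := Finset.mem_range.mp hj
    have hij : i + j < n := by omega
    rcases le_or_gt n (i + j + s₀) with h | h
    · exact (hlarge i j hij h).trans (le_add_of_nonneg_right hG)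
    · exact (hsmall i j hij h).trans (le_add_of_nonneg_left hF)
  calc ∑ i ∈ range n, ∑ j ∈ range (n - i), f i j
      ≤ ∑ i ∈ range n, ∑ _j ∈ range (n - i), (F + G) :=
        Finset.sum_le_sum fun i hi => Finset.sum_le_sum fun j hj => hpt i hi j hj
    _ ≤ ∑ _i ∈ range n, (n : ℝ) * (F + G) := by
        refine Finset.sum_le_sum fun i _ => ?_
        rw [Finset.sum_const, Finset.card_range, nsmul_eq_mul]
        have h1 : ((n - i : ℕ) : ℝ) ≤ n := by exact_mod_cast Nat.sub_le n i
        exact mul_le_mul_of_nonneg_right h1 (add_nonneg hF hG)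
    _ = (n : ℝ) ^ 2 * (F + G) := by rw [Finset.sum_const, Finset.card_range, nsmul_eq_mul]; ring

/-! ### The criterion -/

/-- **From per-box bounds on the large boxes to the Möbius–Walsh sum.** Let `S = A.map val` and
`u, B ≥ 1, s₀` be given. If for both digit sets `T ∈ {S, S ∪ {n}}` and every LARGE box
`i + j < n ≤ i + j + s₀` one has `|boxSum T i j (typeICoeff u) 1| ≤ E_I` and
`|boxSum T i j (typeIICoeffA u B) (typeIICoeffB u)| ≤ E_II` (`E_I, E_II ≥ 0`), then

  `|walshSum μ A| ≤ 2u + n²(E_I + 2^{n-s₀}(n+1)) + B n²(E_II + 2^{n-s₀}) + 2ⁿ(n+1)⁴/B`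

(the tree's Vaughan reduction `abs_walshSum_moebius_le_boxes`, the trivial bounds on the small
boxes, `1 + log 2^{i+1} ≤ n + 1`). [cite: Bourgain2013MoebiusWalsh, §3 (reduction to (2.1), (3.1)) and (3.10)] -/
theorem abs_walshSum_moebius_le_of_boxBounds (n u B s₀ : ℕ) (hB : 1 ≤ B) (A : Finset (Fin n))
    {EI EII : ℝ} (hEI : 0 ≤ EI) (hEII : 0 ≤ EII)
    (hI : ∀ T : Finset ℕ, (T = A.map Fin.valEmbedding ∨ T = insert n (A.map Fin.valEmbedding)) →
      ∀ i j : ℕ, i + j < n → n ≤ i + j + s₀ → |boxSum T i j (typeICoeff u) (fun _ => 1)| ≤ EI)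
    (hII : ∀ T : Finset ℕ, (T = A.map Fin.valEmbedding ∨ T = insert n (A.map Fin.valEmbedding)) →
      ∀ i j : ℕ, i + j < n → n ≤ i + j + s₀ →
        |boxSum T i j (typeIICoeffA u B) (typeIICoeffB u)| ≤ EII) :
    |walshSum (fun m => (μ m : ℤ)) A| ≤
      2 * u + (n : ℝ) ^ 2 * (EI + 2 ^ (n - s₀) * (n + 1)) +
        B * ((n : ℝ) ^ 2 * (EII + 2 ^ (n - s₀))) + 2 ^ n * ((n : ℝ) + 1) ^ 4 / B := by
  set S : Finset ℕ := A.map Fin.valEmbedding with hS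
  have hlog : ∀ i : ℕ, i < n → 1 + Real.log ((2 : ℝ) ^ (i + 1)) ≤ n + 1 := by
    intro i hi
    rw [Real.log_pow]
    have h2 : Real.log 2 ≤ 1 := by
      have := Real.log_two_lt_d9; linarith
    have h3 : ((i + 1 : ℕ) : ℝ) * Real.log 2 ≤ (i + 1 : ℕ) := by
      have := mul_le_mul_of_nonneg_left h2 (Nat.cast_nonneg (i + 1)); simpa using this
    have h4 : ((i + 1 : ℕ) : ℝ) ≤ n := by exact_mod_cast hi
    linarith
  have hlog0 : ∀ i : ℕ, 0 ≤ 1 + Real.log ((2 : ℝ) ^ (i + 1)) := fun i => by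
    have := Real.log_nonneg (one_le_pow₀ (M₀ := ℝ) one_le_two (n := i + 1)); linarith
  -- small boxes
  have hsmallI : ∀ T : Finset ℕ, ∀ i j : ℕ, i + j < n → i + j + s₀ < n →
      |boxSum T i j (typeICoeff u) (fun _ => 1)| ≤ 2 ^ (n - s₀) * (n + 1) := by
    intro T i j hij hsm
    refine (abs_boxSum_typeI_trivial T i j u).trans ?_
    have h1 : (2 : ℝ) ^ (i + j + 1) ≤ 2 ^ (n - s₀) := pow_le_pow_right₀ one_le_two (by omega)
    exact mul_le_mul h1 (hlog i (by omega)) (hlog0 i) (by positivity)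
  have hsmallII : ∀ T : Finset ℕ, ∀ i j : ℕ, i + j < n → i + j + s₀ < n →
      |boxSum T i j (typeIICoeffA u B) (typeIICoeffB u)| ≤ 2 ^ (n - s₀) := by
    intro T i j hij hsm
    refine (abs_boxSum_typeII_trivial T i j u hB).trans ?_
    exact pow_le_pow_right₀ one_le_two (by omega)
  -- the two double sums
  have hsumI : ∑ i ∈ range n, ∑ j ∈ range (n - i),
      (|boxSum S i j (typeICoeff u) (fun _ => 1)| +
        |boxSum (insert n S) i j (typeICoeff u) (fun _ => 1)|) ≤
      (n : ℝ) ^ 2 * (2 * EI + 2 * (2 ^ (n - s₀) * (n + 1))) := by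
    refine sum_boxes_le (n := n) (s₀ := s₀) (by positivity) (by positivity) ?_ ?_
    · intro i j hij hl
      have h1 := hI S (Or.inl rfl) i j hij hl
      have h2 := hI (insert n S) (Or.inr rfl) i j hij hl
      linarith
    · intro i j hij hs
      have h1 := hsmallI S i j hij hs
      have h2 := hsmallI (insert n S) i j hij hs
      linarith
  have hsumII : ∑ i ∈ range n, ∑ j ∈ range (n - i),
      (|boxSum S i j (typeIICoeffA u B) (typeIICoeffB u)| +
        |boxSum (insert n S) i j (typeIICoeffA u B) (typeIICoeffB u)|) ≤
      (n : ℝ) ^ 2 * (2 * EII + 2 * 2 ^ (n - s₀)) := by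
    refine sum_boxes_le (n := n) (s₀ := s₀) (by positivity) (by positivity) ?_ ?_
    · intro i j hij hl
      have h1 := hII S (Or.inl rfl) i j hij hl
      have h2 := hII (insert n S) (Or.inr rfl) i j hij hl
      linarith
    · intro i j hij hs
      have h1 := hsmallII S i j hij hs
      have h2 := hsmallII (insert n S) i j hij hs
      linarith
  have hB0 : (0 : ℝ) ≤ B := by positivity
  have hmain := abs_walshSum_moebius_le_boxes n u B hB A
  rw [← hS] at hmain
  calc |walshSum (fun m => (μ m : ℤ)) A| ≤ _ := hmain
    _ ≤ 2 * u + (1 / 2) * ((n : ℝ) ^ 2 * (2 * EI + 2 * (2 ^ (n - s₀) * (n + 1)))) +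
          (B / 2) * ((n : ℝ) ^ 2 * (2 * EII + 2 * 2 ^ (n - s₀))) + 2 ^ n * ((n : ℝ) + 1) ^ 4 / B := by
        gcongr
    _ = 2 * u + (n : ℝ) ^ 2 * (EI + 2 ^ (n - s₀) * (n + 1)) +
          B * ((n : ℝ) ^ 2 * (EII + 2 ^ (n - s₀))) + 2 ^ n * ((n : ℝ) + 1) ^ 4 / B := by
        ring

end Literature.NumberTheory.LFunctions.MoebiusWalsh
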